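import Literature.Claims.NS.Moschandreou2022
import Literature.Claims.NS.Moschandreou2024
import Literature.Analysis.FluidPDE.WholeSpaceIBP
import HarnessLib

/-!
# Solo salvage for claim C05b `Moschandreou2022` (cell `ns-claims`, D-0090): the §3.1 «non-smooth
# solution» EXISTS in the typed class — it is a spatially CONSTANT decelerating vertical flow with a
# pressure LINEAR in `z` (printed (B)/(D) leave the pressure free)

Claim skeleton: `Literature/Claims/NS/Moschandreou2022.lean` (typist-7 g2, p481054). Its
`NonSmoothSolutionExists` asks for stationary `U_x, U_y`, a profile `F₅ ≢ 0`, constants `c₄, C₁ > 0`, a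
viscosity and a pressure such that `u = (U_x, U_y, F₄(t)F₅)` — `F₄(t) = (6C₁√c₄ − 6t√c₄)^{1/6}`
extended by `0` past `C₁` — is a classical unforced solution on `[0, C₁)` and on `(C₁, ∞)`,
continuous on `ℝ × ℝ³`, from a smooth divergence-free `ℤ³`-periodic datum, with periodic velocity
slices. WITNESS (typist-7 g2's hand-off note 01:09:13Z, made kernel here): `U_x = U_y = 0`,
`F₅ ≡ 1`, any `c₄, C₁, ν > 0`, `u(t, r) = F₄(t) e₃` (constant in space) and the pressure
`P(t, r) = −F₄'(t) z` for `t < C₁`, `0` after: `∂ₜu = F₄' e₃ = −∇P`, `(u·∇)u = 0`, `Δu = 0`. This is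
the pressure-gauge / parasitic mechanism of the Clay setting without a pressure normalisation
(Koch–Nadirashvili–Seregin–Šverák 2009 §1; tree `Literature/Analysis/FluidPDE/ClaySettingParasiticDrift.lean`,
NEG-TOOLKIT T3), here with a drift that is continuous but not `C¹` at `t = C₁`.

Consequence for the adjudication: with the §3.1 object granted, the skeleton's own
`inference_iff_claim_of_exists` makes Step 6 (`Step_inference` : «a non-smooth solution ⇒ ¬(B)»,
p.4 l.481) EQUIVALENT to the claimed theorem — ROUTE 5b shape; and the datum of the exhibited
solution, the constant field `F₄(0) e₃`, of course HAS a smooth global periodic solution (itself,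
with zero pressure), so nothing about (B) follows from the exhibit.

Decls: `(EuclideanSpace.single 2 (1 : ℝ) : E3)`, `sepField_const`, `base`/`F4` calculus (`continuous_F4`, `hasDerivAt_F4`,
`contDiffOn_F4`), `gaugePressure`, `isClassicalNSSolutionOn_before`, `isClassicalNSSolutionOn_after`,
**`nonSmoothSolutionExists_holds : NonSmoothSolutionExists`**, `step_inference_iff_claimedTheorem`.
Salvage seat ns-claims-salvage-p5 g2 (Moschandreou family lane). Solo lane, no item.

WHAT THIS IS NOT: not a claim about NS regularity or blow-up; not a claim about any author beyond the
typed locator.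
-/

-- lint debt (one line): the Theorems namespace repeats the summit name by the D-0017 layout.
set_option linter.dupNamespace false

noncomputable section

open Set Function Filter
open scoped ContDiff Laplacian InnerProductSpace RealInnerProductSpace Topology

namespace Summit.NavierStokesRegularity.NavierStokesRegularity.Theorems.Moschandreou2022

open Literature.Analysis.FluidPDE
open Literature.Claims.NS.Moschandreou2022

/-! ### The witness field: `u(t, r) = F₄(t) e₃` -/

/-- With `U_x = U_y = 0` and `F₅ ≡ 1` the §3.1 field is `F(t) e₃`, constant in space.
[cite: Moschandreou2022, eqs. (19)–(20) p.4 l.412–421, l.437] -/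
theorem sepField_const (F : ℝ → ℝ) (t : ℝ) (r : E3) :
    sepField 0 0 (fun _ => 1) F t r = F t • (EuclideanSpace.single 2 (1 : ℝ) : E3) := by
  ext i
  fin_cases i <;> simp [sepField]

/-- The same as an identity of slices. [cite: Moschandreou2022, eqs. (19)–(20) p.4 l.412–421] -/
theorem sepField_const_slice (F : ℝ → ℝ) (t : ℝ) :
    sepField 0 0 (fun _ => 1) F t = fun _ => F t • (EuclideanSpace.single 2 (1 : ℝ) : E3) :=
  funext (sepField_const F t)

/-! ### Calculus of the time factor `F₄` -/

/-- The base is positive before `C₁`. [cite: Moschandreou2022, p.4 l.444–447] -/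
theorem base_pos {c₄ C₁ t : ℝ} (hc : 0 < c₄) (ht : t < C₁) : 0 < (6 * C₁ * Real.sqrt c₄ - 6 * t * Real.sqrt c₄) := by
  have hs : 0 < Real.sqrt c₄ := Real.sqrt_pos.2 hc
  nlinarith

/-- The base is continuous and has derivative `−6√c₄`. [folklore] -/
theorem hasDerivAt_base (c₄ C₁ t : ℝ) : HasDerivAt (fun t : ℝ => 6 * C₁ * Real.sqrt c₄ - 6 * t * Real.sqrt c₄) (-(6 * Real.sqrt c₄)) t := by
  have h := ((hasDerivAt_id t).const_mul (6 * Real.sqrt c₄)).const_sub (6 * C₁ * Real.sqrt c₄)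
  refine h.congr_of_eventuallyEq (Eventually.of_forall fun s => ?_) |>.congr_deriv (by simp)
  simp only [id]; ring

/-- `F₄` as a total formula: `F₄(t) = (max(base, 0))^{1/6}`. [cite: Moschandreou2022, p.4 l.444–447 and l.470–478] -/
theorem F4_eq_max_rpow {c₄ : ℝ} (hc : 0 < c₄) (C₁ t : ℝ) :
    F4 c₄ C₁ t = (max ((6 * C₁ * Real.sqrt c₄ - 6 * t * Real.sqrt c₄)) 0) ^ (1 / 6 : ℝ) := by
  have hs : 0 < Real.sqrt c₄ := Real.sqrt_pos.2 hc
  by_cases h : t ≤ C₁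
  · have h0 : (0 : ℝ) ≤ 6 * C₁ * Real.sqrt c₄ - 6 * t * Real.sqrt c₄ := by nlinarith
    rw [F4_of_le h, max_eq_left h0]
  · push Not at h
    have h0 : 6 * C₁ * Real.sqrt c₄ - 6 * t * Real.sqrt c₄ ≤ 0 := by nlinarith
    rw [F4_of_lt h, max_eq_right h0, Real.zero_rpow (by norm_num)]

/-- **`F₄` is continuous on `ℝ`** (Step 4, first half: «Extending F₄ … F₄(t) = 0 if t ∈ (C₁,∞)»).
[cite: Moschandreou2022, p.4 l.470–478] -/
theorem continuous_F4 {c₄ : ℝ} (hc : 0 < c₄) (C₁ : ℝ) : Continuous (F4 c₄ C₁) := by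
  have hfun : F4 c₄ C₁ = fun t => (max ((6 * C₁ * Real.sqrt c₄ - 6 * t * Real.sqrt c₄)) 0) ^ (1 / 6 : ℝ) :=
    funext (F4_eq_max_rpow hc C₁)
  rw [hfun]
  have hb : Continuous (fun t : ℝ => 6 * C₁ * Real.sqrt c₄ - 6 * t * Real.sqrt c₄) := by fun_prop
  exact (hb.max continuous_const).rpow_const fun _ => Or.inr (by norm_num)

/-- **The displayed derivative** (Step 3, first half): for `t < C₁`,
`F₄'(t) = −√c₄/(6C₁√c₄ − 6t√c₄)^{5/6}`. [cite: Moschandreou2022, p.4 l.449–452] -/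
theorem hasDerivAt_F4 {c₄ C₁ t : ℝ} (hc : 0 < c₄) (ht : t < C₁) :
    HasDerivAt (F4 c₄ C₁) (F4deriv c₄ C₁ t) t := by
  have hb0 : (6 * C₁ * Real.sqrt c₄ - 6 * t * Real.sqrt c₄) ≠ 0 := (base_pos hc ht).ne'
  have h1 : HasDerivAt (fun s => (6 * C₁ * Real.sqrt c₄ - 6 * s * Real.sqrt c₄) ^ (1 / 6 : ℝ))
      (-(6 * Real.sqrt c₄) * (1 / 6 : ℝ) * (6 * C₁ * Real.sqrt c₄ - 6 * t * Real.sqrt c₄) ^ ((1 / 6 : ℝ) - 1)) t :=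
    (hasDerivAt_base c₄ C₁ t).rpow_const (Or.inl hb0)
  have heq : (fun s => (6 * C₁ * Real.sqrt c₄ - 6 * s * Real.sqrt c₄) ^ (1 / 6 : ℝ)) =ᶠ[𝓝 t] F4 c₄ C₁ := by
    filter_upwards [Iio_mem_nhds ht] with s hs
    rw [F4_of_le (le_of_lt hs)]
  refine (h1.congr_of_eventuallyEq heq.symm).congr_deriv ?_
  unfold F4deriv
  rw [show (1 / 6 : ℝ) - 1 = -(5 / 6 : ℝ) by norm_num, Real.rpow_neg (base_pos hc ht).le]
  ring

/-- `F₄` is smooth on `(−∞, C₁)` (sixth root of a positive affine function). [folklore] -/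
theorem contDiffOn_F4 {c₄ : ℝ} (hc : 0 < c₄) (C₁ : ℝ) : ContDiffOn ℝ ∞ (F4 c₄ C₁) (Iio C₁) := by
  have hb : ContDiff ℝ ∞ (fun t : ℝ => 6 * C₁ * Real.sqrt c₄ - 6 * t * Real.sqrt c₄) := by fun_prop
  have h : ContDiffOn ℝ ∞ (fun s => (6 * C₁ * Real.sqrt c₄ - 6 * s * Real.sqrt c₄) ^ (1 / 6 : ℝ)) (Iio C₁) := fun s hs =>
    ((hb.contDiffAt).rpow_const_of_ne (base_pos hc hs).ne').contDiffWithinAt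
  exact h.congr fun s hs => by rw [F4_of_le (le_of_lt hs)]

/-- `F₄'` is smooth on `(−∞, C₁)`. [folklore] -/
theorem contDiffOn_F4deriv {c₄ : ℝ} (hc : 0 < c₄) (C₁ : ℝ) :
    ContDiffOn ℝ ∞ (F4deriv c₄ C₁) (Iio C₁) := by
  have hb : ContDiff ℝ ∞ (fun t : ℝ => 6 * C₁ * Real.sqrt c₄ - 6 * t * Real.sqrt c₄) := by fun_prop
  have h : ContDiffOn ℝ ∞ (fun s => -(Real.sqrt c₄ / (6 * C₁ * Real.sqrt c₄ - 6 * s * Real.sqrt c₄) ^ (5 / 6 : ℝ))) (Iio C₁) := by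
    intro s hs
    have hbs := base_pos hc hs
    have hpow : ContDiffAt ℝ ∞ (fun s => (6 * C₁ * Real.sqrt c₄ - 6 * s * Real.sqrt c₄) ^ (5 / 6 : ℝ)) s :=
      (hb.contDiffAt).rpow_const_of_ne hbs.ne'
    have hne : (6 * C₁ * Real.sqrt c₄ - 6 * s * Real.sqrt c₄) ^ (5 / 6 : ℝ) ≠ 0 := (Real.rpow_pos_of_pos hbs _).ne'
    exact ((contDiffAt_const.div hpow hne).neg).contDiffWithinAt
  exact h.congr fun s _ => by unfold F4deriv; rfl

/-! ### The pressure gauge and the two classical pieces -/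

/-- `⟪e₃, r⟫ = z`. [folklore] -/
theorem inner_ez (r : E3) : ⟪(EuclideanSpace.single 2 (1 : ℝ) : E3), r⟫ = r 2 := by
  simp [EuclideanSpace.inner_single_left]

/-- Gradient of `r ↦ c ⟪e₃, r⟫` is `c e₃`. [folklore] -/
theorem hasGradientAt_const_mul_inner (c : ℝ) (r : E3) :
    HasGradientAt (fun r' : E3 => c * ⟪(EuclideanSpace.single 2 (1 : ℝ) : E3), r'⟫) (c • (EuclideanSpace.single 2 (1 : ℝ) : E3)) r := by
  have h : HasGradientAt (fun r' : E3 => ⟪c • (EuclideanSpace.single 2 (1 : ℝ) : E3), r'⟫) (c • (EuclideanSpace.single 2 (1 : ℝ) : E3)) r :=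
    (InnerProductSpace.toDual ℝ E3 (c • (EuclideanSpace.single 2 (1 : ℝ) : E3))).hasFDerivAt
  refine HasFDerivAt.congr_of_eventuallyEq h (Eventually.of_forall fun r' => ?_)
  simp [real_inner_smul_left]

/-- The Laplacian of a constant field vanishes. [folklore] -/
theorem laplacian_const (v : E3) (r : E3) : Δ (fun _ : E3 => v) r = 0 := by
  rw [laplacian_eq_sum_fderiv_fderiv (stdOrthonormalBasis ℝ E3) contDiff_const r]
  simp

/-- **Classical solution on `[0, C₁)`**: `u = F₄(t) e₃`, `P = −F₄'(t) z` solve the unforced system there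
(any `ν`). [cite: Moschandreou2022, p.4 l.437–460 with (1)–(3) §1.2] -/
theorem isClassicalNSSolutionOn_before {c₄ C₁ : ℝ} (hc : 0 < c₄) (ν : ℝ) :
    IsClassicalNSSolutionOn (Ico 0 C₁) ν 0 (sepField 0 0 (fun _ => 1) (F4 c₄ C₁))
      (fun (t : ℝ) (r : E3) => if t < C₁ then -(F4deriv c₄ C₁ t) * ⟪(EuclideanSpace.single 2 (1 : ℝ) : E3), r⟫ else 0) where
  smooth_velocity := by
    have hF : ContDiffOn ℝ ∞ (fun q : ℝ × E3 => F4 c₄ C₁ q.1) (Ico 0 C₁ ×ˢ univ) :=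
      (contDiffOn_F4 hc C₁).comp contDiffOn_fst fun q hq => (mem_prod.1 hq).1.2
    have h : ContDiffOn ℝ ∞ (fun q : ℝ × E3 => F4 c₄ C₁ q.1 • (EuclideanSpace.single 2 (1 : ℝ) : E3)) (Ico 0 C₁ ×ˢ univ) :=
      hF.smul contDiffOn_const
    refine h.congr fun q _ => ?_
    simp [uncurry, sepField_const]
  smooth_pressure := by
    have hF : ContDiffOn ℝ ∞ (fun q : ℝ × E3 => F4deriv c₄ C₁ q.1) (Ico 0 C₁ ×ˢ univ) :=
      (contDiffOn_F4deriv hc C₁).comp contDiffOn_fst fun q hq => (mem_prod.1 hq).1.2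
    have hz : ContDiff ℝ ∞ (fun q : ℝ × E3 => ⟪(EuclideanSpace.single 2 (1 : ℝ) : E3), q.2⟫) := contDiff_const.inner ℝ contDiff_snd
    have h : ContDiffOn ℝ ∞ (fun q : ℝ × E3 => -(F4deriv c₄ C₁ q.1) * ⟪(EuclideanSpace.single 2 (1 : ℝ) : E3), q.2⟫) (Ico 0 C₁ ×ˢ univ) :=
      hF.neg.mul hz.contDiffOn
    refine h.congr fun q hq => ?_
    have hq1 : q.1 < C₁ := (mem_prod.1 hq).1.2
    simp [uncurry, hq1]
  momentum t ht r := by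
    have ht1 : t < C₁ := ht.2
    -- time derivative
    have hderiv : HasDerivWithinAt (fun s => sepField 0 0 (fun _ => 1) (F4 c₄ C₁) s r)
        (F4deriv c₄ C₁ t • (EuclideanSpace.single 2 (1 : ℝ) : E3)) (Ico 0 C₁) t := by
      have h := ((hasDerivAt_F4 hc ht1).smul_const (EuclideanSpace.single 2 (1 : ℝ) : E3)).hasDerivWithinAt (s := Ico 0 C₁)
      exact h.congr (fun s _ => sepField_const _ s r) (sepField_const _ t r)
    rw [timeDerivWithin_apply, hderiv.derivWithin (uniqueDiffOn_Ico 0 C₁ t ht),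
      sepField_const_slice, convect_apply, fderiv_const_apply, laplacian_const]
    -- pressure gradient
    have hP : (fun r : E3 => if t < C₁ then -(F4deriv c₄ C₁ t) * ⟪(EuclideanSpace.single 2 (1 : ℝ) : E3), r⟫ else 0) =
        fun r' => -(F4deriv c₄ C₁ t) * ⟪(EuclideanSpace.single 2 (1 : ℝ) : E3), r'⟫ := by
      funext r'; simp [ht1]
    rw [hP, (hasGradientAt_const_mul_inner _ r).gradient]
    simp
  divFree t _ r := by
    rw [sepField_const_slice, VectorCalculus.divergence, fderiv_const_apply]
    simp

/-- **Classical solution on `(C₁, ∞)`**: there `u ≡ 0` and `P ≡ 0`. [cite: Moschandreou2022, p.4 l.470–478] -/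
theorem isClassicalNSSolutionOn_after {c₄ C₁ : ℝ} (ν : ℝ) :
    IsClassicalNSSolutionOn (Ioi C₁) ν 0 (sepField 0 0 (fun _ => 1) (F4 c₄ C₁))
      (fun (t : ℝ) (r : E3) => if t < C₁ then -(F4deriv c₄ C₁ t) * ⟪(EuclideanSpace.single 2 (1 : ℝ) : E3), r⟫ else 0) where
  smooth_velocity := by
    refine (contDiffOn_const (c := (0 : E3))).congr fun q hq => ?_
    have hq1 : C₁ < q.1 := (mem_prod.1 hq).1
    simp [uncurry, sepField_const, F4_of_lt hq1]
  smooth_pressure := by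
    refine (contDiffOn_const (c := (0 : ℝ))).congr fun q hq => ?_
    have hq1 : C₁ < q.1 := (mem_prod.1 hq).1
    simp [uncurry, not_lt.2 hq1.le]
  momentum t ht r := by
    have ht1 : C₁ < t := ht
    have hderiv : HasDerivWithinAt (fun s => sepField 0 0 (fun _ => 1) (F4 c₄ C₁) s r)
        (0 : E3) (Ioi C₁) t := by
      refine (hasDerivWithinAt_const t (Ioi C₁) (0 : E3)).congr (fun s hs => ?_) ?_
      · rw [sepField_const, F4_of_lt hs, zero_smul]
      · rw [sepField_const, F4_of_lt ht1, zero_smul]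
    have hslice : sepField 0 0 (fun _ => 1) (F4 c₄ C₁) t = fun _ => (0 : E3) := by
      funext r'; rw [sepField_const, F4_of_lt ht1, zero_smul]
    have hP : (fun r : E3 => if t < C₁ then -(F4deriv c₄ C₁ t) * ⟪(EuclideanSpace.single 2 (1 : ℝ) : E3), r⟫ else 0) =
        fun _ => (0 : ℝ) := by
      funext r'; simp [not_lt.2 ht1.le]
    rw [timeDerivWithin_apply, hderiv.derivWithin (uniqueDiffOn_Ioi C₁ t ht), hslice, convect_apply,
      fderiv_const_apply, laplacian_const, hP]
    simp [gradient]
  divFree t ht r := by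
    rw [sepField_const_slice, VectorCalculus.divergence, fderiv_const_apply]
    simp

/-! ### The existence theorem and the ROUTE-5b consequence -/

/-- **The §3.1 «non-smooth solution» EXISTS in the typed class** — witnessed by `U_x = U_y = 0`,
`F₅ ≡ 1`, `c₄ = C₁ = ν = 1`, `u = F₄(t) e₃`, `P = −F₄'(t) z` (`t < C₁`), `0` (`t > C₁`): a spatially
constant, decelerating, vertically moving fluid, continuous in time, not `C¹` at `t = C₁`, carried by a
pressure linear in `z` that the printed problem does not exclude. [cite: Moschandreou2022, abstract p.1 l.127; §3.1 p.4 l.437–481] -/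
theorem nonSmoothSolutionExists_holds : NonSmoothSolutionExists := by
  refine ⟨0, 0, fun _ => 1, 1, 1, 1, (fun (t : ℝ) (r : E3) => if t < 1 then -(F4deriv 1 1 t) * ⟪(EuclideanSpace.single 2 (1 : ℝ) : E3), r⟫ else 0), one_pos, one_pos, one_pos, ⟨0, one_ne_zero⟩,
    ?_, ?_, ?_, isClassicalNSSolutionOn_before one_pos 1, isClassicalNSSolutionOn_after 1,
    ?_, ?_⟩
  · rw [sepField_const_slice]; exact contDiff_const
  · intro r
    rw [sepField_const_slice, NSWave0.divergence, fderiv_const_apply]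
    simp
  · intro j r; rw [sepField_const, sepField_const]
  · have h : Continuous fun q : ℝ × E3 => F4 1 1 q.1 • (EuclideanSpace.single 2 (1 : ℝ) : E3) :=
      ((continuous_F4 one_pos 1).comp continuous_fst).smul continuous_const
    refine h.congr fun q => ?_
    simp [uncurry, sepField_const]
  · intro t _ j r; rw [sepField_const, sepField_const]

/-- **ROUTE-5b consequence, now unconditional**: the Clay inference of p.4 l.481 (`Step_inference` :
«a non-smooth solution exists ⇒ (B) fails») is EQUIVALENT to the claimed theorem — the skeleton's
`inference_iff_claim_of_exists` with its hypothesis discharged. [cite: Moschandreou2022, p.4 l.481] -/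
theorem step_inference_iff_claimedTheorem : Step_inference ↔ ClaimedTheorem :=
  inference_iff_claim_of_exists nonSmoothSolutionExists_holds

/-- And the datum of the exhibited solution — the constant field `F₄(0) e₃` — does have a smooth
global `ℤ³`-periodic solution of the unforced system (itself, with zero pressure): the exhibit decides
nothing about (B). [cite: Moschandreou2022, p.4 l.481] -/
theorem datum_clayPeriodic_solvable {ν : ℝ} (hν : 0 < ν) :
    Literature.Claims.NS.ClayVariants.clayPeriodic.Solvable ν 0 (sepField 0 0 (fun _ => 1) (F4 1 1) 0) := by
  rw [sepField_const_slice]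
  exact Literature.Claims.NS.Moschandreou2024.step_7_holds ν hν _

end Summit.NavierStokesRegularity.NavierStokesRegularity.Theorems.Moschandreou2022

end
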